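import Mathlib
import Summits.Ventures.DiscreteObjects.Mahler.FourTermAbsTwo
import Summits.Ventures.DiscreteObjects.Mahler.FourTermSpecialFamily

/-!
# Quadrinomials with coprime exponents: `M ≥ θ₀` beyond the residual set (venture `DiscreteObjects`, target L)

Cell `pub-namedobj`, seat `pub-namedobj-mahler-g24`. Framing: lottery ticket; floor = certified
bounds/negative ranges.  Part of the kernel REPLICATION of [Dobrowolski2006] E. Dobrowolski, Acta Arith. 123
(2006) 201–231, Proposition 2 (`M ≥ θ₀` for noncyclotomic quadrinomials); not new mathematics.

For `R = x^{p+q} + b x^p + s b x^q + s` with `gcd(p, q) = 1` the cyclotomic parts of the factorisations of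
`FourTermAbsTwo` / `FourTermCyclotomicFactors` / `FourTermSpecialFamily` are tiny (`gcd(q-p, 2p) ≤ 2`,
`gcd(p+q, 3p) ≤ 3`, `deg D ≤ 3(q-p)`), so the resultant bounds give `θ₀` as soon as the degree is moderately large:
`b = ±2` with `p + q ≥ 27` (even route `4^{deg Q} ≤ 2^{deg Q} M^{2(p+q)}`, `deg Q ≥ p+q-5`); `|b| ≥ 3` (odd route
`|b|^{deg Q} ≤ 2^{deg Q} M^{p+q}`, `deg Q ≥ p+q-2` generically, `5 deg Q ≥ 2(p+q)` on the family `p+q = |b|(q-p)`).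

* `gcd_le_two_of_coprime`, `gcd_le_three_of_coprime`; numeric thresholds `pow_13248_le_two` (`n ≥ 27`),
  `pow_13248_le_three_halves` (`n ≥ 7`), `pow_13248_le_two'` (`n ≥ 4`); `smythTheta_le_of_pow_le`;
* `smythTheta_le_measure_quadrinomial_two` (`b = ±2`, `p + q ≥ 27`);
* `odd_route_bound`; `smythTheta_le_measure_quadrinomial_special` (`|b| ≥ 5`, `p+q = |b|(q-p)`),
  `smythTheta_le_measure_quadrinomial_generic` (`|b| ≥ 3` otherwise, `p+q ≥ 6`, `(|b|, p+q) ≠ (3, 6)`).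
-/

namespace Summit.Ventures.DiscreteObjects.Mahler

open Polynomial

section Quadrinomial

variable {p q : ℕ} {b s : ℤ}

/-- `gcd(q - p, 2p) ≤ 2` when `gcd(p, q) = 1` (`p < q`). -/
theorem gcd_le_two_of_coprime (hpq : p < q) (hcop : Nat.Coprime p q) :
    Nat.gcd (q - p) (2 * p) ≤ 2 := by
  have h1 : Nat.Coprime (q - p) p := by
    rw [Nat.Coprime, Nat.gcd_sub_self_left hpq.le, Nat.gcd_comm]; exact hcop
  have h2 : Nat.Coprime (Nat.gcd (q - p) (2 * p)) p := h1.coprime_dvd_left (Nat.gcd_dvd_left _ _)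
  have h3 : Nat.gcd (q - p) (2 * p) ∣ 2 := h2.dvd_of_dvd_mul_right (Nat.gcd_dvd_right _ _)
  exact Nat.le_of_dvd (by norm_num) h3

/-- `gcd(p + q, 3p) ≤ 3` when `gcd(p, q) = 1`. -/
theorem gcd_le_three_of_coprime (hcop : Nat.Coprime p q) : Nat.gcd (p + q) (3 * p) ≤ 3 := by
  have h1 : Nat.Coprime (p + q) p := by
    rw [Nat.Coprime, Nat.add_comm]; simpa [Nat.Coprime, Nat.gcd_comm] using hcop
  have h2 : Nat.Coprime (Nat.gcd (p + q) (3 * p)) p := h1.coprime_dvd_left (Nat.gcd_dvd_left _ _)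
  have h3 : Nat.gcd (p + q) (3 * p) ∣ 3 := h2.dvd_of_dvd_mul_right (Nat.gcd_dvd_right _ _)
  exact Nat.le_of_dvd (by norm_num) h3

/-- `1.3248^{2n} ≤ 2^{n-5}` for `n ≥ 27`. -/
theorem pow_13248_le_two (n : ℕ) (hn : 27 ≤ n) : (13248 / 10000 : ℝ) ^ (2 * n) ≤ 2 ^ (n - 5) := by
  induction n, hn using Nat.le_induction with
  | base => norm_num
  | succ n hn ih =>
    rw [show 2 * (n + 1) = 2 * n + 2 by ring, show n + 1 - 5 = (n - 5) + 1 by omega, pow_add, pow_succ]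
    have h2 : (13248 / 10000 : ℝ) ^ 2 ≤ 2 := by norm_num
    have h0 : (0 : ℝ) ≤ (13248 / 10000 : ℝ) ^ 2 := by positivity
    have h1 : (0 : ℝ) ≤ (2 : ℝ) ^ (n - 5) := by positivity
    exact mul_le_mul ih h2 h0 h1

/-- `1.3248ⁿ ≤ (3/2)^{n-2}` for `n ≥ 7`. -/
theorem pow_13248_le_three_halves (n : ℕ) (hn : 7 ≤ n) : (13248 / 10000 : ℝ) ^ n ≤ (3 / 2) ^ (n - 2) := by
  induction n, hn using Nat.le_induction with
  | base => norm_num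
  | succ n hn ih =>
    rw [show n + 1 - 2 = (n - 2) + 1 by omega, pow_succ, pow_succ]
    have h2 : (13248 / 10000 : ℝ) ≤ 3 / 2 := by norm_num
    exact mul_le_mul ih h2 (by norm_num) (by positivity)

/-- `1.3248ⁿ ≤ 2^{n-2}` for `n ≥ 4`. -/
theorem pow_13248_le_two' (n : ℕ) (hn : 4 ≤ n) : (13248 / 10000 : ℝ) ^ n ≤ 2 ^ (n - 2) := by
  induction n, hn using Nat.le_induction with
  | base => norm_num
  | succ n hn ih =>
    rw [show n + 1 - 2 = (n - 2) + 1 by omega, pow_succ, pow_succ]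
    have h2 : (13248 / 10000 : ℝ) ≤ 2 := by norm_num
    exact mul_le_mul ih h2 (by norm_num) (by positivity)

/-- `θ₀ ≤ M` from `1.3248 < M` or from a power comparison: if `M < θ₀` then `M^a < 1.3248^a`. -/
theorem smythTheta_le_of_pow_le {M c : ℝ} {a : ℕ} (ha : a ≠ 0) (hM : 0 ≤ M)
    (h : c ≤ M ^ a) (hc : (13248 / 10000 : ℝ) ^ a ≤ c) : smythTheta ≤ M := by
  by_contra hlt
  push Not at hlt
  have h1 : M < 13248 / 10000 := lt_trans hlt smythTheta_lt
  have h2 : M ^ a < (13248 / 10000 : ℝ) ^ a := pow_lt_pow_left₀ h1 hM ha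
  linarith

/-- **`|b| = 2`, long case** ([Dobrowolski2006, §5, the doubling step]): for `gcd(p, q) = 1`, `b = ±2` and
`p + q ≥ 27` the quadrinomial has `M ≥ θ₀` — `R = C_A C_B Q` (`FourTermAbsTwo`), `deg C_A ≤ gcd(q-p, 2p) ≤ 2`,
`deg C_B ≤ gcd(p+q, 3p) ≤ 3`, and the even resultant step `4^{deg Q} ≤ 2^{deg Q} M^{2(p+q)}` on `Q`. -/
theorem smythTheta_le_measure_quadrinomial_two (hp : 0 < p) (hpq : p < q) (hcop : Nat.Coprime p q)
    (hs : s = 1 ∨ s = -1) (hbb : b = 2 ∨ b = -2) (hn27 : 27 ≤ p + q) :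
    smythTheta ≤ intMahlerMeasure (X ^ (p + q) + C b * X ^ p + C (s * b) * X ^ q + C s : ℤ[X]) := by
  obtain ⟨hmon, hdeg⟩ := quadrinomial_monic_natDegree hp hpq b s
  set P : ℤ[X] := X ^ (p + q) + C b * X ^ p + C (s * b) * X ^ q + C s with hP
  set n := p + q with hn
  have hP0 : P ≠ 0 := hmon.ne_zero
  have hM0 : 0 ≤ intMahlerMeasure P := by unfold intMahlerMeasure; exact Polynomial.mahlerMeasure_nonneg _
  have hθ : smythTheta < 13248 / 10000 := smythTheta_lt
  have hss : s * s = 1 := by rcases hs with h | h <;> simp [h]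
  obtain ⟨ε, hε, hbε⟩ : ∃ ε : ℤ, (ε = 1 ∨ ε = -1) ∧ b = 2 * ε := by
    rcases hbb with h | h
    · exact ⟨1, Or.inl rfl, by rw [h]; ring⟩
    · exact ⟨-1, Or.inr rfl, by rw [h]; ring⟩
  have hgen : p + q ≠ 2 * (q - p) := by
    intro h
    have h3 : q = 3 * p := by omega
    have : Nat.gcd p q = p := by rw [h3]; exact Nat.gcd_eq_left ⟨3, by ring⟩
    rw [Nat.Coprime] at hcop; omega
  obtain ⟨CA, CB, Q, hPQ, hAW, hAV, hBn, hB3, hcfQ⟩ :=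
    exists_cyclotomicFree_factor_quadrinomial_two hp hpq hs hε hbε hgen
  change P = CA * CB * Q at hPQ
  have hCA0 : CA ≠ 0 := by rintro rfl; rw [zero_mul, zero_mul] at hPQ; exact hP0 hPQ
  have hCB0 : CB ≠ 0 := by rintro rfl; rw [mul_zero, zero_mul] at hPQ; exact hP0 hPQ
  have hQ0 : Q ≠ 0 := by rintro rfl; rw [mul_zero] at hPQ; exact hP0 hPQ
  -- degrees via Euclid on exponents and `gcd = 1`
  have hsign : ∀ {t : ℤ}, (t = 1 ∨ t = -1) → ∀ {N : ℕ}, 0 < N → (X ^ N - C t : ℤ[X]) ≠ 0 :=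
    fun _ _ hN => X_pow_sub_C_ne_zero hN _
  obtain ⟨wA, hwA, hCAd⟩ := dvd_X_pow_gcd_sub_C (F := CA) _ (q - p) (2 * p) (-s) 1 le_rfl (by omega)
    (by omega) (by rcases hs with h | h <;> simp [h]) (Or.inl rfl)
    (by rw [map_neg, sub_neg_eq_add]; exact hAW) (by rw [map_one]; exact hAV)
  obtain ⟨wB, hwB, hCBd⟩ := dvd_X_pow_gcd_sub_C (F := CB) _ (p + q) (3 * p) s (s * ε) le_rfl (by omega)
    (by omega) hs (by rcases hs with h | h <;> rcases hε with h' | h' <;> simp [h, h']) hBn hB3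
  have hdA : CA.natDegree ≤ 2 := by
    have := natDegree_le_of_dvd hCAd (hsign hwA (Nat.gcd_pos_of_pos_right _ (by omega)))
    rw [natDegree_X_pow_sub_C] at this
    exact this.trans (gcd_le_two_of_coprime hpq hcop)
  have hdB : CB.natDegree ≤ 3 := by
    have := natDegree_le_of_dvd hCBd (hsign hwB (Nat.gcd_pos_of_pos_right _ (by omega)))
    rw [natDegree_X_pow_sub_C] at this
    exact this.trans (gcd_le_three_of_coprime hcop)
  have hdegs : CA.natDegree + CB.natDegree + Q.natDegree = n := by
    rw [← hdeg, hPQ, natDegree_mul (mul_ne_zero hCA0 hCB0) hQ0, natDegree_mul hCA0 hCB0]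
  have hQn : n - 5 ≤ Q.natDegree := by omega
  -- measures of the cyclotomic parts and the even resultant step on `Q`
  have hMA : intMahlerMeasure CA = 1 := by
    obtain ⟨V', hV'⟩ := hAV
    exact intMahlerMeasure_eq_one_of_mul_eq_X_pow_sub_one (by omega : 0 < 2 * p) hV'.symm
  have hMB : intMahlerMeasure CB = 1 := by
    obtain ⟨V', hV'⟩ := hB3
    have hsε2 : (s * ε) * (s * ε) = 1 := by rcases hs with h | h <;> rcases hε with h' | h' <;> simp [h, h']
    have e : CB * (V' * (X ^ (3 * p) + C (s * ε))) = X ^ (6 * p) - 1 := by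
      rw [← mul_assoc, ← hV']
      have hC : (C (s * ε) : ℤ[X]) * C (s * ε) = 1 := by rw [← map_mul, hsε2, map_one]
      linear_combination (-1 : ℤ[X]) * hC
    exact intMahlerMeasure_eq_one_of_mul_eq_X_pow_sub_one (by omega : 0 < 6 * p) e
  have hMQ : intMahlerMeasure Q = intMahlerMeasure P := by
    rw [hPQ, intMahlerMeasure_mul, intMahlerMeasure_mul, hMA, hMB, one_mul, one_mul]
  set T : ℤ[X] := X ^ p + C s * X ^ q with hT
  have hCs : (C s : ℤ[X]) * C s = 1 := by rw [← map_mul, hss, map_one]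
  have hG : (X ^ (2 * n) - 1 : ℤ[X]) =
      C (4 * ε) * (T * (C ε * T + C s)) + Q * (CA * CB * (P - C (4 * ε) * T - C (2 * s))) := by
    have e : Q * (CA * CB * (P - C (4 * ε) * T - C (2 * s))) = P * (P - C (4 * ε) * T - C (2 * s)) := by
      rw [hPQ]; ring
    rw [e, hP, hT, hbε]
    simp only [map_mul, map_ofNat]
    linear_combination hCs
  have hGdeg : (X ^ (2 * n) - 1 : ℤ[X]).natDegree ≤ 2 * n := by rw [← C_1, natDegree_X_pow_sub_C]
  have hne : Q.resultant (X ^ (2 * n) - 1) Q.natDegree (2 * n) ≠ 0 :=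
    resultant_X_pow_sub_one_ne_zero hQ0 hcfQ (by omega)
  have hTdeg : T.natDegree ≤ q := by
    rw [hT]
    refine (natDegree_add_le _ _).trans (max_le ?_ ?_)
    · rw [natDegree_X_pow]; omega
    · exact (natDegree_C_mul_le _ _).trans (by rw [natDegree_X_pow])
  have hHdeg : (CA * CB * (P - C (4 * ε) * T - C (2 * s))).natDegree + Q.natDegree ≤ 2 * n := by
    have h1 : (P - C (4 * ε) * T - C (2 * s)).natDegree ≤ n := by
      refine (natDegree_sub_le _ _).trans (max_le ((natDegree_sub_le _ _).trans (max_le ?_ ?_)) ?_)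
      · rw [hdeg]
      · exact (natDegree_C_mul_le _ _).trans (hTdeg.trans (by omega))
      · rw [natDegree_C]; omega
    have h2 : (CA * CB * (P - C (4 * ε) * T - C (2 * s))).natDegree ≤
        (CA * CB).natDegree + (P - C (4 * ε) * T - C (2 * s)).natDegree := natDegree_mul_le
    rw [natDegree_mul hCA0 hCB0] at h2
    omega
  have hroot : ∀ α : ℂ, ‖((X ^ (2 * n) - 1 : ℤ[X]).map (Int.castRingHom ℂ)).eval α‖ ≤
      2 * max 1 ‖α‖ ^ (2 * n) := by
    intro α
    simp only [Polynomial.map_sub, Polynomial.map_pow, map_X, Polynomial.map_one, eval_sub, eval_pow,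
      eval_X, eval_one]
    have := norm_pow_add_le_two_mul α (-1) (by simp) (2 * n)
    rwa [← sub_eq_add_neg] at this
  have h := abs_pow_le_pow_mul_measure_pow_of_resultant (K := 2) hG hHdeg hGdeg hne hroot
  rw [hMQ] at h
  set M := intMahlerMeasure P with hMdef
  have h4 : (|((4 : ℤ) * ε : ℤ)| : ℝ) = 2 * 2 := by rcases hε with h' | h' <;> simp [h'] <;> norm_num
  rw [h4, mul_pow] at h
  have h2 : (2 : ℝ) ^ Q.natDegree ≤ M ^ (2 * n) := by
    have hpos : (0 : ℝ) < 2 ^ Q.natDegree := by positivity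
    nlinarith
  have h3 : (2 : ℝ) ^ (n - 5) ≤ M ^ (2 * n) := le_trans (pow_le_pow_right₀ (by norm_num) hQn) h2
  exact smythTheta_le_of_pow_le (by omega) hM0 h3 (pow_13248_le_two n hn27)

/-- **Odd resultant route on a factorisation.**  If the quadrinomial `R = x^{p+q} + b x^p + s b x^q + s` factors as
`R = C · Q` with `M(C) = 1` and `Q` cyclotomic-free, then `|b|^{deg Q} ≤ 2^{deg Q} · M(R)^{p+q}`
(`x^{p+q} + s = b·(-T) + Q·C`, `|αⁿ + s| ≤ 2 max(1,|α|)ⁿ`). -/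
theorem odd_route_bound (hp : 0 < p) (hpq : p < q) (hs : s = 1 ∨ s = -1) {Cy Q : ℤ[X]}
    (hPQ : (X ^ (p + q) + C b * X ^ p + C (s * b) * X ^ q + C s : ℤ[X]) = Cy * Q)
    (hMCy : intMahlerMeasure Cy = 1) (hcfQ : ∀ k : ℕ, 0 < k → ¬ cyclotomic k ℤ ∣ Q) :
    (|b| : ℝ) ^ Q.natDegree ≤ 2 ^ Q.natDegree *
      intMahlerMeasure (X ^ (p + q) + C b * X ^ p + C (s * b) * X ^ q + C s : ℤ[X]) ^ (p + q) := by
  obtain ⟨hmon, hdeg⟩ := quadrinomial_monic_natDegree hp hpq b s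
  set P : ℤ[X] := X ^ (p + q) + C b * X ^ p + C (s * b) * X ^ q + C s with hP
  set n := p + q with hn
  have hP0 : P ≠ 0 := hmon.ne_zero
  have hCy0 : Cy ≠ 0 := by rintro rfl; rw [zero_mul] at hPQ; exact hP0 hPQ
  have hQ0 : Q ≠ 0 := by rintro rfl; rw [mul_zero] at hPQ; exact hP0 hPQ
  have hdegs : Cy.natDegree + Q.natDegree = n := by rw [← hdeg, hPQ, natDegree_mul hCy0 hQ0]
  have hMQ : intMahlerMeasure Q = intMahlerMeasure P := by rw [hPQ, intMahlerMeasure_mul, hMCy, one_mul]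
  have hG : (X ^ n + C s : ℤ[X]) = C b * (-(X ^ p + C s * X ^ q)) + Q * Cy := by
    rw [mul_comm Q Cy, ← hPQ, hP, map_mul]; ring
  have hGdeg : (X ^ n + C s : ℤ[X]).natDegree ≤ n := by rw [natDegree_X_pow_add_C]
  have hne : Q.resultant (X ^ n + C s) Q.natDegree n ≠ 0 := by
    refine resultant_ne_zero_of_cyclotomicFree (L := 2 * n) hQ0 hcfQ hGdeg (by omega) ?_
    intro z hz
    simp only [Polynomial.map_add, Polynomial.map_pow, map_X, eq_intCast, Polynomial.map_intCast,
      eval_add, eval_pow, eval_X, eval_intCast] at hz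
    have hz' : z ^ n = -(s : ℂ) := eq_neg_of_add_eq_zero_left hz
    rw [pow_mul', hz', neg_sq]
    rcases hs with h | h <;> simp [h]
  have hroot : ∀ α : ℂ, ‖((X ^ n + C s : ℤ[X]).map (Int.castRingHom ℂ)).eval α‖ ≤ 2 * max 1 ‖α‖ ^ n := by
    intro α
    simp only [Polynomial.map_add, Polynomial.map_pow, map_X, eq_intCast, Polynomial.map_intCast,
      eval_add, eval_pow, eval_X, eval_intCast]
    exact norm_pow_add_le_two_mul α (s : ℂ) (norm_intCast_le_one_of_sign hs) n
  have h := abs_pow_le_pow_mul_measure_pow_of_resultant (K := 2) hG (by omega) hGdeg hne hroot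
  rw [hMQ] at h
  exact_mod_cast h

/-- **The special family with `|b| ≥ 5`** (`p + q = |b|(q - p)`): `R = D·Q` with `D ∣ (x^{q-p} + s)³`
(`FourTermSpecialFamily`), so `5 deg Q ≥ 2(p+q)` and the odd route gives `(5/2)^2 ≤ M⁵`. -/
theorem smythTheta_le_measure_quadrinomial_special (hp : 0 < p) (hpq : p < q) (hs : s = 1 ∨ s = -1)
    (hb5 : 5 ≤ |b|) (hfam : p + q = b.natAbs * (q - p)) :
    smythTheta ≤ intMahlerMeasure (X ^ (p + q) + C b * X ^ p + C (s * b) * X ^ q + C s : ℤ[X]) := by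
  obtain ⟨hmon, hdeg⟩ := quadrinomial_monic_natDegree hp hpq b s
  set P : ℤ[X] := X ^ (p + q) + C b * X ^ p + C (s * b) * X ^ q + C s with hP
  set n := p + q with hn
  have hP0 : P ≠ 0 := hmon.ne_zero
  have hM0 : 0 ≤ intMahlerMeasure P := by unfold intMahlerMeasure; exact Polynomial.mahlerMeasure_nonneg _
  have hθ : smythTheta < 13248 / 10000 := smythTheta_lt
  have hss : s * s = 1 := by rcases hs with h | h <;> simp [h]
  have hb3 : 3 ≤ |b| := by omega
  have hB : (b.natAbs : ℤ) = |b| := Int.natCast_natAbs b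
  obtain ⟨D, Q, hPQ, hDW, hcfQ⟩ := exists_cyclotomicFree_factor_quadrinomial_three hp hpq hs hb3
  change P = D * Q at hPQ
  have hD0 : D ≠ 0 := by rintro rfl; rw [zero_mul] at hPQ; exact hP0 hPQ
  have hQ0 : Q ≠ 0 := by rintro rfl; rw [mul_zero] at hPQ; exact hP0 hPQ
  have hW0 : ((X ^ (q - p) + C s : ℤ[X]) ^ 3) ≠ 0 := pow_ne_zero 3 (monic_X_pow_add_C s (by omega)).ne_zero
  have hdD : D.natDegree ≤ 3 * (q - p) := by
    have := natDegree_le_of_dvd hDW hW0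
    rw [natDegree_pow, natDegree_X_pow_add_C] at this
    omega
  have hdegs : D.natDegree + Q.natDegree = n := by rw [← hdeg, hPQ, natDegree_mul hD0 hQ0]
  have hMD : intMahlerMeasure D = 1 := by
    have hCs : (C s : ℤ[X]) * C s = 1 := by rw [← map_mul, hss, map_one]
    have hW1 : intMahlerMeasure (X ^ (q - p) + C s : ℤ[X]) = 1 := by
      refine intMahlerMeasure_eq_one_of_mul_eq_X_pow_sub_one (s := X ^ (q - p) - C s)
        (by omega : 0 < 2 * (q - p)) ?_
      rw [pow_mul, sq]
      linear_combination (-1 : ℤ[X]) * hCs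
    refine intMahlerMeasure_eq_one_of_dvd hDW hW0 ?_
    rw [show ((X ^ (q - p) + C s : ℤ[X]) ^ 3) = (X ^ (q - p) + C s) * ((X ^ (q - p) + C s) * (X ^ (q - p) + C s))
      by ring, intMahlerMeasure_mul, intMahlerMeasure_mul, hW1]
    norm_num
  have hodd := odd_route_bound hp hpq hs hPQ hMD hcfQ
  -- `5 deg Q ≥ 2 n` since `deg Q ≥ n - 3k = (|b| - 3) k` and `|b| ≥ 5`
  have hQ2 : 2 * n ≤ 5 * Q.natDegree := by
    have hk : n = b.natAbs * (q - p) := hfam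
    have hb5' : 5 ≤ b.natAbs := by omega
    have : Q.natDegree + 3 * (q - p) ≥ b.natAbs * (q - p) := by omega
    nlinarith
  set M := intMahlerMeasure P with hMdef
  have hb52 : (5 / 2 : ℝ) ≤ |(b : ℝ)| / 2 := by
    have : (5 : ℝ) ≤ |(b : ℝ)| := by exact_mod_cast hb5
    linarith
  have h1 : (|(b : ℝ)| / 2) ^ Q.natDegree ≤ M ^ n := by
    rw [div_pow, div_le_iff₀ (by positivity)]
    calc |(b : ℝ)| ^ Q.natDegree ≤ 2 ^ Q.natDegree * M ^ n := by exact_mod_cast hodd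
      _ = M ^ n * 2 ^ Q.natDegree := by ring
  have h2 : (5 / 2 : ℝ) ^ (2 * n) ≤ (M ^ 5) ^ n := by
    calc (5 / 2 : ℝ) ^ (2 * n) ≤ (5 / 2) ^ (5 * Q.natDegree) := pow_le_pow_right₀ (by norm_num) hQ2
      _ ≤ (|(b : ℝ)| / 2) ^ (5 * Q.natDegree) := pow_le_pow_left₀ (by norm_num) hb52 _
      _ = ((|(b : ℝ)| / 2) ^ Q.natDegree) ^ 5 := by rw [mul_comm, pow_mul]
      _ ≤ (M ^ n) ^ 5 := pow_le_pow_left₀ (by positivity) h1 5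
      _ = (M ^ 5) ^ n := by rw [← pow_mul, ← pow_mul, mul_comm]
  have h3 : (25 / 4 : ℝ) ≤ M ^ 5 := by
    have e : (5 / 2 : ℝ) ^ (2 * n) = (25 / 4) ^ n := by rw [pow_mul]; norm_num
    rw [e] at h2
    exact le_of_pow_le_pow_left₀ (by omega : n ≠ 0) (by positivity) h2
  exact smythTheta_le_of_pow_le (by norm_num) hM0 h3 (by norm_num)

/-- **The generic case `|b| ≥ 3`** (`p + q ≠ |b|(q - p)`, `gcd(p, q) = 1`): `R = C·Q` with
`C ∣ x^{gcd(q-p, 2p)} - w`, `deg C ≤ 2` (`FourTermCyclotomicFactors`), and the odd route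
`(|b|/2)^{p+q-2} ≤ M^{p+q}`; needs `p + q ≥ 6`, and `p + q ≠ 6` when `|b| = 3` (that case is `(1,5)`, a
certificate). -/
theorem smythTheta_le_measure_quadrinomial_generic (hp : 0 < p) (hpq : p < q) (hcop : Nat.Coprime p q)
    (hs : s = 1 ∨ s = -1) (hb3 : 3 ≤ |b|) (hfam : ¬ p + q = b.natAbs * (q - p)) (hn6 : 6 ≤ p + q)
    (h36 : |b| = 3 → p + q ≠ 6) :
    smythTheta ≤ intMahlerMeasure (X ^ (p + q) + C b * X ^ p + C (s * b) * X ^ q + C s : ℤ[X]) := by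
  obtain ⟨hmon, hdeg⟩ := quadrinomial_monic_natDegree hp hpq b s
  set P : ℤ[X] := X ^ (p + q) + C b * X ^ p + C (s * b) * X ^ q + C s with hP
  set n := p + q with hn
  have hP0 : P ≠ 0 := hmon.ne_zero
  have hM0 : 0 ≤ intMahlerMeasure P := by unfold intMahlerMeasure; exact Polynomial.mahlerMeasure_nonneg _
  have hθ : smythTheta < 13248 / 10000 := smythTheta_lt
  have hss : s * s = 1 := by rcases hs with h | h <;> simp [h]
  obtain ⟨Cy, Q, hPQ, hCW, hCV, hcfQ⟩ := exists_cyclotomicFree_factor_quadrinomial hp hpq hs hb3 hfam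
  change P = Cy * Q at hPQ
  have hCy0 : Cy ≠ 0 := by rintro rfl; rw [zero_mul] at hPQ; exact hP0 hPQ
  have hQ0 : Q ≠ 0 := by rintro rfl; rw [mul_zero] at hPQ; exact hP0 hPQ
  obtain ⟨w, hw, hCd⟩ := dvd_X_pow_gcd_sub_C (F := Cy) _ (q - p) (2 * p) (-s) 1 le_rfl (by omega)
    (by omega) (by rcases hs with h | h <;> simp [h]) (Or.inl rfl)
    (by rw [map_neg, sub_neg_eq_add]; exact hCW) (by rw [map_one]; exact hCV)
  have hdC : Cy.natDegree ≤ 2 := by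
    have hne : (X ^ Nat.gcd (q - p) (2 * p) - C w : ℤ[X]) ≠ 0 :=
      X_pow_sub_C_ne_zero (Nat.gcd_pos_of_pos_right _ (by omega)) _
    have := natDegree_le_of_dvd hCd hne
    rw [natDegree_X_pow_sub_C] at this
    exact this.trans (gcd_le_two_of_coprime hpq hcop)
  have hdegs : Cy.natDegree + Q.natDegree = n := by rw [← hdeg, hPQ, natDegree_mul hCy0 hQ0]
  have hQn : n - 2 ≤ Q.natDegree := by omega
  have hMCy : intMahlerMeasure Cy = 1 := by
    obtain ⟨V', hV'⟩ := hCV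
    exact intMahlerMeasure_eq_one_of_mul_eq_X_pow_sub_one (by omega : 0 < 2 * p) hV'.symm
  have hodd := odd_route_bound hp hpq hs hPQ hMCy hcfQ
  set M := intMahlerMeasure P with hMdef
  have hb32 : (3 / 2 : ℝ) ≤ |(b : ℝ)| / 2 := by
    have : (3 : ℝ) ≤ |(b : ℝ)| := by exact_mod_cast hb3
    linarith
  have h1 : (|(b : ℝ)| / 2) ^ Q.natDegree ≤ M ^ n := by
    rw [div_pow, div_le_iff₀ (by positivity)]
    calc |(b : ℝ)| ^ Q.natDegree ≤ 2 ^ Q.natDegree * M ^ n := by exact_mod_cast hodd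
      _ = M ^ n * 2 ^ Q.natDegree := by ring
  by_cases hb4 : |b| = 3 ∨ |b| = 4
  · -- `|b| = 3`: `(3/2)^{n-2} ≤ Mⁿ` and `n ≥ 7` (n = 6 is the extra certificate); `|b| = 4`: `2^{n-2} ≤ Mⁿ`
    have h2 : (|(b : ℝ)| / 2) ^ (n - 2) ≤ M ^ n :=
      le_trans (pow_le_pow_right₀ (by linarith) hQn) h1
    rcases hb4 with h3 | h4
    · have hn7 : 7 ≤ n := by have := h36 h3; omega
      have h3R : |(b : ℝ)| / 2 = 3 / 2 := by
        have : |(b : ℝ)| = 3 := by exact_mod_cast h3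
        rw [this]
      rw [h3R] at h2
      exact smythTheta_le_of_pow_le (by omega) hM0 h2 (pow_13248_le_three_halves n hn7)
    · have h4R : |(b : ℝ)| / 2 = 2 := by
        have : |(b : ℝ)| = 4 := by exact_mod_cast h4
        rw [this]; norm_num
      rw [h4R] at h2
      exact smythTheta_le_of_pow_le (by omega) hM0 h2 (pow_13248_le_two' n (by omega))
  · -- `|b| ≥ 5`: `3 deg Q ≥ n`, `(5/2)ⁿ ≤ M^{3n}`
    have hb5 : 5 ≤ |b| := by omega
    have hb52 : (5 / 2 : ℝ) ≤ |(b : ℝ)| / 2 := by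
      have : (5 : ℝ) ≤ |(b : ℝ)| := by exact_mod_cast hb5
      linarith
    have hQ3 : n ≤ 3 * Q.natDegree := by omega
    have h2 : (5 / 2 : ℝ) ^ n ≤ (M ^ 3) ^ n := by
      calc (5 / 2 : ℝ) ^ n ≤ (5 / 2) ^ (3 * Q.natDegree) := pow_le_pow_right₀ (by norm_num) hQ3
        _ ≤ (|(b : ℝ)| / 2) ^ (3 * Q.natDegree) := pow_le_pow_left₀ (by norm_num) hb52 _
        _ = ((|(b : ℝ)| / 2) ^ Q.natDegree) ^ 3 := by rw [mul_comm, pow_mul]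
        _ ≤ (M ^ n) ^ 3 := pow_le_pow_left₀ (by positivity) h1 3
        _ = (M ^ 3) ^ n := by rw [← pow_mul, ← pow_mul, mul_comm]
    have h3 : (5 / 2 : ℝ) ≤ M ^ 3 := le_of_pow_le_pow_left₀ (by omega : n ≠ 0) (by positivity) h2
    exact smythTheta_le_of_pow_le (by norm_num) hM0 h3 (by norm_num)


end Quadrinomial

end Summit.Ventures.DiscreteObjects.Mahler
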